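import Mathlib
import HarnessLib
import HarnessLib.Audit
import Summits.CriticalPhenomena.Statement
import Literature.Probability.RandomPlanarGeometry.RestrictionHulls
import HarnessLib.Audit.Status.Attr

/-!
Route: SAWRingGibbsDescent

DORMANT since 2026-08-26T04:21:51Z (reconciler: no traction for 8.3 d (last activity item-evidence-added at 2026-08-17T19:24:59Z); parked, not closed — `ledger route dormant route-CriticalPhenomena-SAWRingGibbsDescent --off` to reactiva) — unstaffed, not closed; items shared with open routes are served there. `ledger route dormant <id> --off` reactivates.

# Route SAWRingGibbsDescent — critical SAW ring = two free random-walk excursions; the chordal SAW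
by Gibbs descent from the ring

It suffices to show X = (R) ∧ (C) ∧ (I) ∧ (A) ∧ (G), realising card
ring-two-excursions-gibbs-descent (LSW04 Prediction 3, rest(2), taken as the PRIMARY lattice target,
and the chordal SAW recovered as "the ring seen from one arc"):
(R) RingSquaredExcursion — on δℤ² the critical self-avoiding RING pinned at a_δ, b_δ (ordered pairs
of interior-disjoint x_c-weighted SAWs a_δ → b_δ of Ω_δ) avoids a boundary hull asymptotically
exactly as often as TWO INDEPENDENT simple-random-walk excursions a_δ → b_δ do: P^ring_δ[both arcs ⊆
cl D'] − (P^exc_δ[ω ⊆ cl D'])² → 0 for every hull subdomain D' (integer exponent 2 = 1 + 1; no 5/8,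
no SLE, no conformal map in the statement);
(C) DomainContinuity — the critical SAW law depends continuously on a moving wall (a chord of a
fixed ambient domain; continuity at SIMPLE limit walls, rev 3) and on the pins, UNIFORMLY in δ;
(I) Rest2Rigidity — continuum: a wall-indexed family of chordal laws, continuous at simple limit
walls, that is the right-resampling kernel of a swap-symmetric pair of disjoint simple arcs whose
fill has the rest(2) avoidance law is chordal SLE_{8/3} in the wall domain of every simple wall (rev
3);
(A) RingLimitArcs — the ring's two arcs are eventually tight as curves and their subsequential
limits are simple, disjoint off {a, b}, boundary-avoiding;
(G) GibbsDescent — the ring's exact lattice Gibbs property (arc given arc = x_c-SAW of the slit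
graph) carries (R), (C), (A) onto the hypotheses of (I) and identifies every subsequential SAW limit
(SubseqIdentification), whence the conjunct by tightness and Prokhorov.
Lean: `RingSquaredExcursion ∧ DomainContinuity ∧ Rest2Rigidity ∧ RingLimitArcs ∧ GibbsDescent`

## Assembly
Deciding theorem (rev 2): `closes := fun hR hC hI hA hG hS hT hRB hSC hE hAsm => hAsm (hG hR hC hI
hA hE hT) hT` — GibbsDescent turns RingSquaredExcursion, DomainContinuity, Rest2Rigidity,
RingLimitArcs, ExcursionRatio, EventualTight into SubseqIdentification, and Assembly :=
SubseqIdentification → EventualTight → SAWScalingLimit is Prokhorov + uniqueness, provable now from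
Literature `convergesInLawToSLE_of_isTightMeasureSet_image'` (SLEUniquenessInLaw.lean: CurveClass ℂ
Polish, IsSLECurve.map_eq_holds, subsequence principle for 𝓝[>]0) with SAW.aemeasurable_curve, once
the junk meshes where a_δ, b_δ are not joined (law = 0, eventually excluded by
IsEndpointApprox.reachable) are handled. The eleven printed facts that rev 1 prepended as
antecedents (SLE_{8/3} existence/uniqueness, LSW03 Thm 6.1 transposed, chordal uniformizers, Jordan
curve/arc theorems, Carathéodory extension, Jordan–Schoenflies, Φ_A, Φ'_A(0), kernel continuity) are
theorems of the tree by now (IsSLECurve.map_eq_holds, IsSLELaw.hullRestriction_eightThirds_holds,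
MarkedDomain.exists_isChordalUniformizing_holds, JordanCurveTheorem_holds,
JordanArcSeparation_holds, JordanDomain.exists_continuousOn_extension_holds,
JordanDomain.isSimplyConnected_holds, IsStarHull.existsUnique_isRestrictionMap_holds,
IsStarHull.exists_hasRestrictionDeriv_holds, HasRestrictionDeriv.tendsto_of_kernel_holds,
exists_isSLECurve_eightThirds) and appear in no item; the route file imports only RestrictionHulls
beyond the statement (MarkedDomain.IsHullSubdomain and ConformalEquiv.pullbackHull are written out),
which takes HullRestrictionSLE / HullExhaustion / JordanCurve and their 44-module cone (CritPercSLE,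
RestrictionMeasures with the unproved exists_isRestrictionMeasure_iff) out of the route.

Rationale: WHY THIS LINE. Mechanism (probabilistic model + potential theory brought to bear): LSW04
(LawlerSchrammWerner2004SAW, arXiv:math/0204277 §2.4 and Prediction 3, p.17) and Werner
(Werner2005ConformalRestriction = arXiv:math/0307353 §7.4 p.35, §7.5 Prop. 14 p.36) say that two
SLE_{8/3} conditioned not to intersect, endpoints fused, fill like the union of two independent
Brownian excursions (restriction exponents add, ξ̃(5/8, 5/8) = 2), and that given one boundary arc
of a rest(2) sample the other arc is chordal SLE_{8/3} in the complementary component (α = 2 ⇒ α₀ =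
5/8 ⇒ ρ₀ = 0). We reverse LSW's implication: the lattice target is the INTEGER identity "critical
ring hull = two free random-walk excursions", a probability-versus-probability statement for two
random sets on ONE graph (couplings, monotone hull comparisons under domain changes, exact linear
algebra on the RW side, exact finite checks), and the chordal walk is recovered through the ring's
exact two-sided Gibbs structure by a resampling/uniqueness identification imported from multiple-SLE
theory (BeffaraPeltolaWu2021, MillerSheffield2016) run backwards, plus one uniform-in-δ
domain-continuity input. Imported: Brownian/random-walk potential theory (excursion Poisson kernels,
KozdronLawler2005, YadinYehudayoff2011), conformal restriction (LawlerSchrammWerner2003Restriction,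
Werner2004Girsanov, Lawler2005ConformallyInvariant Cor. 9.18), multiple-SLE resampling uniqueness.
What prior routes do not do: SAWConfRestriction / SAWRestrictionRigidity identify the ONE-curve
limit through its own 5/8 restriction covariance or an axiom list, SAWParafermion through an
observable, SAWLeftRightFKG through an FKG inequality; here conformal invariance enters only through
the simple random walk (two excursions), which is exactly the embedding-sensitive input Beffara's
barrier demands, and identification is by CONDITIONAL LAW of one arc given the other, not by
covariance of the single curve. Negatives index: only stmt-CriticalPhenomena-0772 (tightness over
all δ), avoided by eventual (∃ δ₀) forms and reachability guards throughout.

RANKED CRUXES. #2 RingSquaredExcursion (crux) — (card K1 'RingHull', scalar form) For every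
Dobrushin domain D, every hull subdomain D' (MarkedDomain.IsHullSubdomain: D ∖ D' away from a, b),
and every endpoint approximation (a_δ, b_δ) that is eventually ring-reachable, the ring law (ordered
pairs of interior-vertex-disjoint DomainSAWs a_δ → b_δ, weight x_c^{|γ₁|+|γ₂|} = SAW.weight ⊗
SAW.weight restricted and normalised) satisfies P^ring_δ[γ₁ ⊆ cl D' ∧ γ₂ ⊆ cl D'] − (P^exc_δ[ω ⊆ cl
D'])² → 0 as δ → 0⁺, where P^exc_δ is the simple random walk from a_δ on Ω_δ (weights 4^{-|ω|},
killed off the graph, stopped at its first visit to b_δ) conditioned to reach b_δ — the discrete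
excursion a_δ → b_δ. [difficulty: open-problem] (why it might fail: It is LSW04 Prediction 3 in RW
form (open, CI-strength: 2 = 5/8+5/8+3/4); pin-local geometry or Kennedy–Lawler boundary lattice
factors might fail to cancel in one of the two ratios for wild IsEndpointApprox pins.)
[LawlerSchrammWerner2004SAW, Werner2005ConformalRestriction, DuplantierSaleur1986,
KennedyLawler2013, MadrasSlade1993]
#3 DomainContinuity (crux) — (rev 3, refuter g2 on stmt-CriticalPhenomena-7525 with evidence
DomainContinuity_cex.md: the LIMIT wall η is required SIMPLE, η ∈ CurveClass.simple — as typed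
before, collapsed two-sided fjords = non-injective limit walls with the same range made the
statement imply ¬SAWScalingLimit) (card K2 = NoHugging + EndpointLocality) Fix an ambient Dobrushin
domain D. For walls η_n → η in CurveClass ℂ with right wall-domains W_n, W (Dobrushin domains inside
D with the same marks and frontier = wall ∪ D.arc 1), pins (aⁿ_δ, bⁿ_δ) uniformly close to a, b and
pins (a_δ, b_δ) of W with IsEndpointApprox: for every bounded continuous f and ε > 0 there are N, δ₀
with |E f(SAW of W_n at mesh δ) − E f(SAW of W at mesh δ)| < ε for all n ≥ N and δ < δ₀ whenever
both pin pairs are joined in their graphs — the map (wall, pins) ↦ critical SAW law is continuous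
uniformly in the mesh, fractal (dimension-4/3) walls included. [difficulty: XL] (why it might fail:
Needs no-hugging of ε-collars of ROUGH simple limit walls and pin locality uniformly in δ;
Kennedy–Lawler boundary lattice effects must stay in normalisations, not laws; thin fjords of W_n at
finite n must be entered only with vanishing probability.) [KennedyLawler2013,
LawlerSchrammWerner2004SAW, DuminilCopinKozmaYadin2014, DuminilCopinHammond2013]
#4 Rest2Rigidity (crux) — (rev 3, refuter g2 companion fix: P's wall-continuity is ASKED and the
conclusion DRAWN at simple walls only; the passage from Q-a.e. arcs to every simple wall is
Rest2Support, layer 2) (continuum identification; no fact antecedents since rev 2 — the SLE /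
restriction / uniformizer / Jordan / Carathéodory inputs are theorems of the tree, and the
pulled-back hull A = closure(ℍ ∖ φ⁻¹D') is written out) In a Dobrushin domain D let P assign to
every wall η (with right wall-domain W: Dobrushin, W ⊆ D, same marks, ∂W = η ∪ D.arc 1) a law on
curves, wall-continuously (η_n → η in CurveClass ℂ ⇒ P η_n ⇒ P η); let Q be a swap-symmetric
probability law on pairs of simple, boundary-avoiding chords a → b, disjoint off {a, b}, such that
(Gibbs) conditionally on the first arc η and on the second lying to its right the second arc has law
P η, and (rest(2)) Q[both arcs ⊆ cl D'] = Φ'_A(0)² for every hull subdomain D' = φ(ℍ ∖ A). Then P η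
is the chordal SLE_{8/3} law of W for EVERY wall. Plan: fill of Q is rest(2) ⇒ Q is THE rest(2)
boundary pair (arcs = boundary of the fill; LSW03 Lemma 3.2 transposed) ⇒ by Rest2Boundary its
right-resampling kernel is SLE_{8/3}(W(η)) ⇒ P η = SLE for a.e. left arc ⇒ everywhere by
wall-continuity of P and of SLE_{8/3} (SLEDomainContinuity) and full support of the left arc of two
excursions. [difficulty: L] (why it might fail: The rest(2) resampling kernel must be SLE_{8/3} with
ρ = 0 (Werner Prop. 14 at α = 2, 'heuristic, can be made rigorous'); the support/continuity transfer
needs SLE_{8/3} wall-continuity up to the marked points (Radó-type input not yet in the library).)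
[Werner2005ConformalRestriction, Werner2004Girsanov, LawlerSchrammWerner2003Restriction,
BeffaraPeltolaWu2021, MillerSheffield2016, Lawler2005ConformallyInvariant]
#5 RingLimitArcs (crux) — (card K3 'SetsToCurves', ring form) For every Dobrushin domain and every
ring-reachable endpoint approximation, the ring's arc pair laws (pushed to CurveClass ℂ × CurveClass
ℂ) are EVENTUALLY TIGHT (∃ δ₀; two-strand Aizenman–Burchard / Kemppainen–Smirnov bounds; eventual
form, cf. the refuted all-δ stmt-CriticalPhenomena-0772) and every subsequential weak limit Q is
carried by pairs of SIMPLE chords from a to b in cl D that meet ∂D only at a, b and each other only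
at a, b. [difficulty: L] (why it might fail: Tightness of critical SAW strands is open (no
annulus-crossing bound at x_c in print), and macroscopic self- /mutual touching of the two strands
through microscopic bottlenecks must have vanishing probability — a two-strand no-pinching estimate
not in print (DCKY Problem 10 nearby).) [LawlerSchrammWerner2004SAW, DuminilCopinKozmaYadin2014,
KennedyLawler2013, AizenmanBurchard1999, KemppainenSmirnov2017]
#6 GibbsDescent (crux) — (card 'descent': the walk is the ring seen from one arc)
RingSquaredExcursion → DomainContinuity → Rest2Rigidity → RingLimitArcs → ExcursionRatio →
EventualTight → SubseqIdentification (no fact antecedents since rev 2): for ANY endpoint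
approximation of (D; a, b), every subsequential weak limit μ of the critical SAW laws along s_n → 0⁺
is the chordal SLE_{8/3} law. Plan: bulge D across arc 0 to D⁺ so that D is the right wall-domain of
η₀ = D.arc 0; along a subsequence extract the ring pair limit Q in D⁺ (tightness half of
RingLimitArcs) and SAW limits P η in wall-domains (EventualTight on a dense countable set +
DomainContinuity); the EXACT lattice Gibbs property (given γ₁ and its side, γ₂ minus its two
end-edges is the x_c-SAW of the slit graph between neighbours of the pins) passes to the limit as
the resampling identity because DomainContinuity is kernel equicontinuity; RingSquaredExcursion +
ExcursionRatio + portmanteau + kernel continuity give the rest(2) fill; RingLimitArcs the arc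
regularity; Rest2Rigidity gives P η₀ = SLE_{8/3}(D); DomainContinuity in the pins gives μ = P η₀.
[deps: RingSquaredExcursion, DomainContinuity, Rest2Rigidity, RingLimitArcs] [difficulty: L] (why it
might fail: Passing the singular conditioning 'given the left arc' to the limit needs equicontinuity
of slit-domain SAW laws exactly at rough lattice walls with pins on the wall (end-edge surgery,
largest-component pockets); a gap there forces an averaged, hull-conditioned descent instead.)
[LawlerSchrammWerner2004SAW, MadrasSlade1993, BeffaraPeltolaWu2021, Billingsley1999,
KozdronLawler2005]
#9 Rest2Boundary (support) — (continuum; Werner arXiv:math/0307353 Prop. 14 at α = 2, made rigorous;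
no fact antecedents since rev 2) Every swap-symmetric probability law Q on pairs of simple,
disjoint, boundary-avoiding chords of (D; a, b) whose fill has the rest(2) avoidance law Q[both ⊆ cl
D'] = Φ'_A(0)² has the SLE_{8/3} right-resampling property: conditionally on the first arc η and on
the second lying to its right, the second is chordal SLE_{8/3} of the right wall-domain of η (stated
for any kernel P with IsSLELaw (8/3) (S η) (P η) on E; the SLE_{8/3} law of a Dobrushin domain
exists and is unique, exists_isSLECurve_eightThirds / IsSLECurve.map_eq_holds). Contains: uniqueness
of such Q (arcs = boundary of the fill, LSW03 Lemma 3.2 transposed) and the identification of the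
rest(2) boundary pair with 'SLE_{8/3}(2), then SLE_{8/3} in the complement' (Lawler 2005 Cor. 9.18:
right boundary of the fill of k = 2 excursions is SLE(8/3, 2)). [difficulty: L]
[Werner2005ConformalRestriction, Werner2004Girsanov, Lawler2005ConformallyInvariant,
LawlerSchrammWerner2003Restriction, Wu2015]
#9 SLEDomainContinuity (support) — (rev 3: simple limit wall, so that ∂W_n → ∂W as curves and Radó
applies; non-injective limits excluded on purpose) In every Dobrushin domain D the chordal SLE_{8/3}
laws μ_n, μ (IsSLELaw (8/3); no fact antecedents since rev 2) of right wall-domains W_n, W with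
walls η_n → η in CurveClass ℂ (marks fixed) converge weakly, μ_n ⇒ μ. Route: Radó's theorem
(normalised Riemann maps onto Jordan domains converge uniformly on the closed disc when the boundary
curves converge as curves; cite request filed) with IsSLECurve = boundary-extension image of the
half-plane trace; away from the marks also by restriction + kernel continuity of Φ'_A(0).
[difficulty: M] [PommerenkeBBCM1992, RohdeSchramm2005, LawlerSchrammWerner2003Restriction,
Lawler2005ConformallyInvariant]
#9 ExcursionRatio (support) — (card P-item; invariance principle for excursions) For D, a hull
subdomain D', an endpoint approximation, a chordal uniformizer φ of D and the restriction map Φ_A of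
A = closure(ℍ ∖ φ⁻¹D') (ConformalEquiv.pullbackHull written out since rev 2) with Φ'_A(0) = d:
P^exc_δ[ω ⊆ cl D'] → d, i.e. the discrete excursion a_δ → b_δ of Ω_δ (as in RingSquaredExcursion)
stays in cl D' with probability tending to the Brownian excursion's (LSW03 Prop. 4.1: the excursion
avoids A with probability Φ'_A(0)). [difficulty: M] [KozdronLawler2005,
LawlerSchrammWerner2003Restriction, YadinYehudayoff2011, LawlerLimic2010]
#9 EventualTight (support) — (shared with route SAWRestrictionRigidity, stmt-CriticalPhenomena-1372,
identical signature) eventual tightness of the pushed-forward critical SAW laws in every Dobrushin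
domain for every endpoint approximation; used in the Assembly (Prokhorov) and inside GibbsDescent
(limits in wall-domains). [difficulty: L] [KemppainenSmirnov2017, AizenmanBurchard1999,
DuminilCopinHammond2013]
#9 SubseqIdentification (support) — (shared with route SAWParafermion, stmt-CriticalPhenomena-0783,
identical signature; here it is the OUTPUT of GibbsDescent and is filed only to mark the junction of
the routes) every subsequential weak limit of the critical SAW laws in (D; a, b), for every endpoint
approximation, is the chordal SLE_{8/3} law. [difficulty: open-problem] [LawlerSchrammWerner2004SAW,
LawlerSchrammWerner2003Restriction]
#1 Assembly (assembly) — SubseqIdentification → EventualTight → SAWScalingLimit (rev 2; provable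
now: Literature convergesInLawToSLE_of_isTightMeasureSet_image' = Prokhorov + subsequence principle
+ IsSLECurve.map_eq_holds, with SAW.aemeasurable_curve and the junk-mesh repair of SAW.law); the
deciding theorem `closes` feeds it GibbsDescent's output. [difficulty: provable-now]
[Billingsley1999, DuminilCopinSmirnov2012]

TWO-LAYER PLAN. Foreseen glued splits, none filed now (k ≤ 3, depth 1): DomainContinuity ⇐ NoHugging
(uniform ε-collar avoidance of rough walls away from a, b) → EndpointLocality (pin insensitivity) →
DomainContinuity; GibbsDescent ⇐ LatticeGibbs (exact conditional law with end-edge surgery and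
pocket bookkeeping) → KernelLimit (equicontinuous kernels pass conditional laws to weak limits) →
GibbsDescent; Rest2Rigidity ⇐ Rest2Support (the left arc of two excursions charges every
neighbourhood of every simple chord) → IdentificationGlue → Rest2Rigidity; RingSquaredExcursion ⇐
one-sided hulls → two-sided hulls → RingSquaredExcursion.

KILL CRITERIA. A refutation of RingSquaredExcursion (a certified enumeration or strip
transfer-matrix trend showing P^ring/P^exc² drifting away from 1 for some hull, or a proof that the
ring's hull exponent is not 2) closes the route outright (close --reason
refuted:RingSquaredExcursion) and is negative knowledge about LSW04 Prediction 3 in RW form.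
Rest2Boundary refuted (the rest(2) resampling kernel is SLE_{8/3}(ρ), ρ ≠ 0, or the arcs touch)
kills the descent as designed: pivot Rest2Rigidity/GibbsDescent to that kernel or close.
RingLimitArcs refuted (touching with positive probability) ⇒ pivot to a hull-level, regions-first
descent (card hyperspace-capacity-connectedness). DomainContinuity refuted at rough walls ⇒ pivot to
an averaged descent (identification for a.e. wall plus a weaker continuity); refuted at the pins ⇒
the conjunct as typed (all IsEndpointApprox) is itself in danger — report to the negatives side.
SubseqIdentification proved on another route moots GibbsDescent (not RingSquaredExcursion, which
keeps independent value as Prediction 3).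

NOT DECOMPOSED YET. The lattice Gibbs identity with its end-edge surgery and largest-component
pocket bookkeeping (inside GibbsDescent); Rest2Support and the transfer 'avoidance of hull
subdomains determines the fill law' (inside Rest2Rigidity / Rest2Boundary); Radó's theorem (cite
request) inside SLEDomainContinuity; one- versus two-sided hulls and any rate in
RingSquaredExcursion; uniformity of the ring tightness over subdomains; the pentagonal ladder (2j
mutually avoiding strands fill like j(3j+1)/2 excursions) as further integer tests. All are layer-2
children or --supports lemmas, later.

CHEAPEST FALSIFIER. (1) Small exact enumeration, a kit job any refuter can run: in an L × L lattice
square (L ≤ 9), a = bottom-middle, b = top-middle boundary-adjacent vertices, A = a one-sided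
boundary notch of depth ⌊L/3⌋; compute Z^ring_{Ω∖A}/Z^ring_Ω at x_c ≈ 0.37905 (pairs of
vertex-disjoint SAWs, transfer matrix or DFS) and (H_{Ω∖A}/H_Ω(a, b))² (one linear solve); their
quotient should drift toward 1 with L while the one-walk analogue Z_{Ω∖A}/Z_Ω ÷
(H_{Ω∖A}/H_Ω)^{5/8}-type comparison does not stabilise at exponent 1 — a clear wrong-way drift
retires RingSquaredExcursion cheaply. Not run here (compute-free hub; left to the refuter). (2)
Literature check of Rest2Boundary — done: Werner arXiv:math/0307353 p.35 ('when b = 5/8 … α = 2 …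
two SLE_{8/3} conditioned not to intersect = filling of two independent Brownian excursions') and
p.36 Prop. 14 (given the right boundary, the left boundary is the image of SLE(8/3, ρ₀), ρ₀ = ρ(α₀);
α = 2 forces α₀ = 5/8, ρ₀ = 0), Lawler 2005 Cor. 9.18 (k = 2 ⇒ v = 3/4, ρ = 8v/3 = 2): consistent.

NUMBERS. Restriction exponents add under independent filled union, rest(1) ⊕ rest(1) = rest(2)
(LSW04 §2.2, p.6); non-intersection exponent ξ̃(5/8, 5/8) = 2 (Werner arXiv:math/0307353 p.35);
surface watermelon exponents x̃_L = L(3L+2)/8, x̃_1 = 5/8, x̃_2 = 2 (DuplantierSaleur1986); right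
boundary of the fill of k excursions = SLE(8/3, 8v/3), v = ¼√(1+24k) − 1, k = 2 ⇒ ρ = 2
(Lawler2005ConformallyInvariant Thm 9.17 / Cor. 9.18, pp.221–222); P_α exists iff α ≥ 5/8 and only
P_{5/8} is a simple curve (LSW03); ladder j ↦ j(3j+1)/2 = 2, 7, 15, …; x_c = 1/μ(ℤ²), 2.6 ≤ μ ≤ 2.7.
Items at open: 11 (5 cruxes, 5 supports, 1 assembly); rev 2 (route-repair, 2026-08-15): same 11 decl
names, 7 restated (RingSquaredExcursion, Rest2Rigidity, GibbsDescent, Rest2Boundary,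
SLEDomainContinuity, ExcursionRatio, Assembly), imports = [RestrictionHulls], route cone 84 → 41
modules.

DEFINITION REQUESTS. None blocking: the ring law, the discrete excursion mass, walls / wall-domains
and the side event are inlined over SAW.weight, SAW.DomainSAW, discreteDomainGraph walks,
DobrushinDomain, CurveClass (Sketch.lean elaborates, rc 0). Convenience definitions worth adding
later (not filed now): SAW.ringLaw, LatticeModels.excursionMass, DobrushinDomain.IsWallDomain. Cite
fact wanted: Radó's theorem (PommerenkeBBCM1992 §2.4) for SLEDomainContinuity — filed as a cite
workitem after open.

Novelty: Searches (2026-08-15): `lit search --hybrid "self-avoiding polygon scaling limit restriction measure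
hull two Brownian excursions"` (12 book hits: Lawler 2005 ch. 9, Madras–Slade, Guttmann ed. Polygons
— none on a pinned-ring scaling limit); `lit galaxy search --star all` for 'two SLE8/3 conditioned
not to intersect' and 'self-avoiding polygon scaling limit' (0 substring hits each) and `--star pdf
--mode bm25` on the ring/rest(2)/conditioning question (12: Werner arXiv:math/0307353 [read
pp.34–36], Wu 2015 survey doi:10.1214/15-PS259, Smirnov ICM, Dubédat commuting SLEs — none states
the descent); `lit read arxiv:math/0204277` (pp.6–7, 17); `lit read` Lawler 2005 pp.221–222 (Thm
9.17, Cor. 9.18); `lit search "Kozdron Lawler exit probabilities excursion Poisson kernel"` (held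
doi:10.1214/ejp.v10-294; remote APIs rate-limited); `lit frontier CriticalPhenomena --since 2021`
(30 rows; nearest arXiv:2605.04395 anchored clusters/SLE excursions, arXiv:2310.17299
sub-ballisticity; nothing on SAP or rest(2)); `lit bridges CriticalPhenomena --cross any` (nothing
relevant); ledger: 138 cards of the sub, 6 route files, negatives (1).
Nearest prior art found: LawlerSchrammWerner2004SAW Prediction 3 (μ_sap(z, w; D) → rest(2), stated
as a consequence of Prediction 1) and Werner2005ConformalRestriction Prop. 14 (boundary-arc
construction of two-sided restriction samples; at α = 2 the second arc given the first is
SLE_{8/3}); in-hub the integer hull identity appears only as a test line of car  [refs: 10.1214/15-PS259, 10.1214/ejp.v10-294, math/0307353, math/0204277, 2605.04395, 2310.17299, doi:10.1214/15-PS259, arxiv:math/0204277, doi:10.1214/ejp.v10-294, BeffaraPeltolaWu2021]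

Barriers (technique_class: integer-hull-identity gibbs-descent rw-comparison): - technique_class: integer-hull-identity gibbs-descent rw-comparison
- Literature.Barriers.CriticalPhenomena.NienhuisWeightsExcludeVertexSAW: evaded by kind — no
parafermionic observable and no exact local linear relation (not_hasExactVertexRelationZ2) is used;
the only exact lattice identities are restriction and the Gibbs factorisation of the ring, valid for
uniform weights on ℤ².
- Literature.Barriers.CriticalPhenomena.ParafermionicHalfCauchyRiemann: not engaged (no discrete
holomorphicity anywhere).
- Literature.Barriers.CriticalPhenomena.EmbeddingModulusUniqueness: conformal invariance is never
upgraded from lattice symmetries; it is imported from the simple random walk (two excursions,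
ExcursionRatio), whose isotropy singles out the square embedding — the embedding-sensitive input
Beffara's argument demands is the discrete Poisson kernel.
- Literature.Barriers.CriticalPhenomena.SAWNotKineticallyGrown: not engaged — no growth process or
consistent kinetic measure; static Gibbs conditioning of the two-strand x_c-measure.
- Literature.Barriers.CriticalPhenomena.SupercriticalSAWSpaceFilling: every lattice item is pinned
at x = x_c (SAW.weight); for x > x_c the ring fills Ω and RingSquaredExcursion is false,
consistently with DCKY Theorem 1.
- Literature.Barriers.CriticalPhenomena.GridSAWCountingSharpPComplete: no exact evaluation of Z^ring
or Z is sought, only ratio asymptotics; the falsifier uses small certified enumerations only.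
- Literature.Barriers.CriticalPhenomena.SA

History (route lifecycle, newest last):
- 2026-08-15T16:44:35Z · rev 2: restated RingSquaredExcursion (stmt-CriticalPhenomena-7524), Rest2Rigidity (stmt-CriticalPhenomena-7526), GibbsDescent (stmt-CriticalPhenomena-7528), Rest2Boundary (stmt-CriticalPhenomena-7529), SLEDomainContinuity (stmt-CriticalPhenomena-7530), ExcursionRatio (stmt-CriticalPhenomena-7531), Assembly (stmt-Critic (planner-rbadge-CriticalPhenomena-SAWRingGibbsD-9dcee22e-g4-0)
- 2026-08-15T17:01:22Z · rev 3: restated DomainContinuity (stmt-CriticalPhenomena-7525), Rest2Rigidity (stmt-CriticalPhenomena-11277), SLEDomainContinuity (stmt-CriticalPhenomena-11280) — precision repair after refuter g2 (unit rchoice-CriticalPhenomena-SAWRingGibbs-1791b568, on top of rev 2 by rbadge-9dcee22e which re-routed around exists_isS (planner-rchoice-CriticalPhenomena-SAWRingGibbs-1791b568-0)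
- 2026-08-26T04:21:51Z · DORMANT — reconciler: no traction for 8.3 d (last activity item-evidence-added at 2026-08-17T19:24:59Z); parked, not closed — `ledger route dormant route-CriticalPhenomen (operator:999:2284356)

sub-problem: SAWScalingLimit · status: dormant · opened planner-plancard-CriticalPhenomena-SAWScaling-aaecc62c-0 2026-08-15T12:11:22Z · rev 4 · ledger route-CriticalPhenomena-SAWRingGibbsDescent
GENERATED by the gate from the ledger (D-0016/17). Provers cite these decls: `theorem foo : Summit.CriticalPhenomena.SAWScalingLimit.Theses.SAWRingGibbsDescent.<Decl> := …` in Summits/CriticalPhenomena/SAWScalingLimit/Theorems/<Name>.lean.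
-/

namespace Summit.CriticalPhenomena.SAWScalingLimit.Theses.SAWRingGibbsDescent

open scoped BigOperators Topology Manifold Classical MeasureTheory ProbabilityTheory Matrix InnerProductSpace ComplexConjugate ContinuousMap
open Filter Set Function TopologicalSpace MeasureTheory

attribute [summit_statement] _root_.SAWScalingLimit

-- earlier RingSquaredExcursion (stmt-CriticalPhenomena-7524, replaced 2026-08-15T16:44:35Z -> stmt-CriticalPhenomena-11155): retired by None — ∀ (D D' : Literature.Probability.RandomPlanarGeometry.DobrushinDomain) (a b : ℝ → Literature.Probability.LatticeModels.Site 2), Literature.Probability.RandomPlanarGeometry.SAW.IsEndpointApprox D a b → D.IsHullSubdomain D' → (∀ᶠ δ in nhdsWithin (0 : ℝ) (Set.Io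
/-- item stmt-CriticalPhenomena-11276 · crux · rank 2 · open · by planner
why it might fail: It is LSW04 Prediction 3 in RW form (open, CI-strength: 2 = 5/8+5/8+3/4); pin-local geometry or Kennedy–Lawler boundary lattice factors might fail to cancel in one of the two ratios for wild IsEndpointApprox pins.
sources: LawlerSchrammWerner2004SAW, Werner2005ConformalRestriction, DuplantierSaleur1986, KennedyLawler2013, MadrasSlade1993
[crux] (card K1 'RingHull', scalar form; rev 2: the hull-subdomain predicate
MarkedDomain.IsHullSubdomain is written out — D' ⊆ D, same marks, a, b ∉ cl(D ∖ D') — so the route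
file needs no import beyond RestrictionHulls) For every Dobrushin domain D, every hull subdomain D',
and every endpoint approximation (a_δ, b_δ) that is eventually ring-reachable, the ring law (ordered
pairs of interior-vertex-disjoint DomainSAWs a_δ → b_δ, weight x_c^{|γ₁|+|γ₂|} = SAW.weight ⊗
SAW.weight restricted and normalised) satisfies P^ring_δ[γ₁ ⊆ cl D' ∧ γ₂ ⊆ cl D'] − (P^exc_δ[ω ⊆ cl
D'])² → 0 as δ → 0⁺, where P^exc_δ is the simple random walk from a_δ on Ω_δ (weights 4^{-|ω|},
killed off the graph, stopped at its first visit to b_δ) conditioned to reach b_δ — the discrete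
excursion a_δ → b_δ. [difficulty: open-problem] -/
@[route_item "route-CriticalPhenomena-SAWRingGibbsDescent", crux]
def RingSquaredExcursion : Prop :=
  ∀ (D D' : Literature.Probability.RandomPlanarGeometry.DobrushinDomain) (a b : ℝ → Literature.Probability.LatticeModels.Site 2), Literature.Probability.RandomPlanarGeometry.SAW.IsEndpointApprox D a b → (D'.carrier ⊆ D.carrier ∧ D'.pt 0 = D.pt 0 ∧ D'.pt 1 = D.pt 1 ∧ D.pt 0 ∉ closure (D.carrier \ D'.carrier) ∧ D.pt 1 ∉ closure (D.carrier \ D'.carrier)) → (∀ᶠ δ in nhdsWithin (0 : ℝ) (Set.Ioi 0), ∃ p : Literature.Probability.RandomPlanarGeometry.SAW.DomainSAW D.carrier δ (a δ) (b δ) × Literature.Probability.RandomPlanarGeometry.SAW.DomainSAW D.carrier δ (a δ) (b δ), ∀ v, v ∈ p.1.walk.support → v ∈ p.2.walk.support → v = a δ ∨ v = b δ) → (let ring : (δ : ℝ) → MeasureTheory.Measure (Literature.Probability.RandomPlanarGeometry.SAW.DomainSAW D.carrier δ (a δ) (b δ) × Literature.Probability.RandomPlanarGeometry.SAW.DomainSAW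 D.carrier δ (a δ) (b δ)) := fun δ => (let R : MeasureTheory.Measure (Literature.Probability.RandomPlanarGeometry.SAW.DomainSAW D.carrier δ (a δ) (b δ) × Literature.Probability.RandomPlanarGeometry.SAW.DomainSAW D.carrier δ (a δ) (b δ)) := ((Literature.Probability.RandomPlanarGeometry.SAW.weight D.carrier δ (a δ) (b δ)).prod (Literature.Probability.RandomPlanarGeometry.SAW.weight D.carrier δ (a δ) (b δ))).restrict {p : Literature.Probability.RandomPlanarGeometry.SAW.DomainSAW D.carrier δ (a δ) (b δ) × Literature.Probability.RandomPlanarGeometry.SAW.DomainSAW D.carrier δ (a δ) (b δ) | ∀ v, v ∈ p.1.walk.support → v ∈ p.2.walk.support → v = (a δ) ∨ v = (b δ)}; (R Set.univ)⁻¹ • R); let exc : (δ : ℝ) → Set ℂ → ENNReal := fun δ S => ∑' ω : (Literature.Probability.LatticeModels.discreteDomainGraph D.carrier δ).Walk (a δ) (b δ), Set.indicator {ω | ω.support.count (b δ) = 1 ∧ Literature.Probability.RandomPlanarGeometry.CurveClass.mk (⟨ω.toCurve (Literature.Probability.LatticeModels.meshPoint δ)⟩ : Literature.Probability.RandomPlanarGeometry.Curve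 ℂ) ∈ Literature.Probability.RandomPlanarGeometry.CurveClass.rangeSubset S} (fun ω => (4 : ENNReal)⁻¹ ^ ω.length) ω; Filter.Tendsto (fun δ => (ring δ {p : Literature.Probability.RandomPlanarGeometry.SAW.DomainSAW D.carrier δ (a δ) (b δ) × Literature.Probability.RandomPlanarGeometry.SAW.DomainSAW D.carrier δ (a δ) (b δ) | p.1.curve ∈ Literature.Probability.RandomPlanarGeometry.CurveClass.rangeSubset (closure D'.carrier) ∧ p.2.curve ∈ Literature.Probability.RandomPlanarGeometry.CurveClass.rangeSubset (closure D'.carrier)}).toReal - ((exc δ (closure D'.carrier) / exc δ Set.univ).toReal) ^ 2) (nhdsWithin 0 (Set.Ioi 0)) (nhds 0))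

-- earlier DomainContinuity (stmt-CriticalPhenomena-7525, replaced 2026-08-15T17:01:22Z -> stmt-CriticalPhenomena-11309): retired by None — ∀ (D : Literature.Probability.RandomPlanarGeometry.DobrushinDomain), (let IsWall : Literature.Probability.RandomPlanarGeometry.CurveClass ℂ → Literature.Probability.RandomPlanarGeometry.DobrushinDomain → Prop := fun η W => W.carrier ⊆ D.carrier ∧ W.pt 0 = D.pt 0 
/-- item stmt-CriticalPhenomena-11309 · crux · rank 3 · open · by planner
why it might fail: Needs no-hugging of ε-collars of ROUGH simple limit walls and pin locality uniformly in δ; Kennedy–Lawler boundary lattice effects must stay in normalisations, not laws; thin fjords of W_n at finite n must be entered only with vanishing probability.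
sources: KennedyLawler2013, LawlerSchrammWerner2004SAW, DuminilCopinKozmaYadin2014, DuminilCopinHammond2013
[crux] (card K2 = NoHugging + EndpointLocality; REPAIRED 2026-08-15 after refuter g2 on
stmt-CriticalPhenomena-7525: the LIMIT wall is a simple arc) Fix an ambient Dobrushin domain D. For
walls η_n → η in CurveClass ℂ with η ∈ CurveClass.simple and right wall-domains W_n, W (Dobrushin
domains inside D with the same marks and frontier = wall ∪ D.arc 1), pins (aⁿ_δ, bⁿ_δ) uniformly
close to a, b and pins (a_δ, b_δ) of W with IsEndpointApprox: for every bounded continuous f and ε >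
0 there are N, δ₀ with |E f(SAW of W_n at mesh δ) − E f(SAW of W at mesh δ)| < ε for all n ≥ N and δ
< δ₀ whenever both pin pairs are joined in their graphs — the map (wall, pins) ↦ critical SAW law is
continuous at simple limit walls, uniformly in the mesh, fractal (dimension-4/3) walls included.
Simplicity of η excludes exactly the collapsed two-sided fjords (non-injective limit walls with the
same range, forcing boundary hugging) under which the unrestricted statement implied
¬SAWScalingLimit (evidence DomainContinuity_cex.md on stmt-CriticalPhenomena-7525); the descent
needs continuity only at Q-typical arcs (simple by RingLimitArcs) and at η₀ = D.arc 0. [difficulty: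
XL] -/
@[route_item "route-CriticalPhenomena-SAWRingGibbsDescent", crux]
def DomainContinuity : Prop :=
  ∀ (D : Literature.Probability.RandomPlanarGeometry.DobrushinDomain), (let IsWall : Literature.Probability.RandomPlanarGeometry.CurveClass ℂ → Literature.Probability.RandomPlanarGeometry.DobrushinDomain → Prop := fun η W => W.carrier ⊆ D.carrier ∧ W.pt 0 = D.pt 0 ∧ W.pt 1 = D.pt 1 ∧ frontier W.carrier = η.range ∪ D.arc 1; ∀ (ηs : ℕ → Literature.Probability.RandomPlanarGeometry.CurveClass ℂ) (η : Literature.Probability.RandomPlanarGeometry.CurveClass ℂ) (Ws : ℕ → Literature.Probability.RandomPlanarGeometry.DobrushinDomain) (W : Literature.Probability.RandomPlanarGeometry.DobrushinDomain) (av bv : ℕ → ℝ → Literature.Probability.LatticeModels.Site 2) (a b : ℝ → Literature.Probability.LatticeModels.Site 2), (∀ n, IsWall (ηs n) (Ws n)) → IsWall η W → η ∈ Literature.Probability.RandomPlanarGeometry.CurveClass.simple → Filter.Tendsto ηs Filter.atTop (nhds η) → Literature.Probability.RandomPlanarGeometry.SAW.IsEndpointApprox W a b → (∀ ε > (0 :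 ℝ), ∀ᶠ δ in nhdsWithin (0 : ℝ) (Set.Ioi 0), ∀ n, dist (Literature.Probability.LatticeModels.meshPoint δ (av n δ)) (D.pt 0) < ε ∧ dist (Literature.Probability.LatticeModels.meshPoint δ (bv n δ)) (D.pt 1) < ε) → ∀ f : BoundedContinuousFunction (Literature.Probability.RandomPlanarGeometry.CurveClass ℂ) ℝ, ∀ ε > (0 : ℝ), ∃ N : ℕ, ∃ δ₀ : ℝ, 0 < δ₀ ∧ ∀ n ≥ N, ∀ δ ∈ Set.Ioo (0 : ℝ) δ₀, (Literature.Probability.LatticeModels.discreteDomainGraph (Ws n).carrier δ).Reachable (av n δ) (bv n δ) → (Literature.Probability.LatticeModels.discreteDomainGraph W.carrier δ).Reachable (a δ) (b δ) → |(∫ γ, f γ.curve ∂(Literature.Probability.RandomPlanarGeometry.SAW.law (Ws n).carrier δ (av n δ) (bv n δ))) - ∫ γ, f γ.curve ∂(Literature.Probability.RandomPlanarGeometry.SAW.law W.carrier δ (a δ) (b δ))| < ε)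

-- earlier Rest2Rigidity (stmt-CriticalPhenomena-11277, replaced 2026-08-15T17:01:22Z -> stmt-CriticalPhenomena-11310): retired by None — ∀ (D : Literature.Probability.RandomPlanarGeometry.DobrushinDomain), (let IsWall : Literature.Probability.RandomPlanarGeometry.CurveClass ℂ → Literature.Probability.RandomPlanarGeometry.DobrushinDomain → Prop := fun η W => W.carrier ⊆ D.carrier ∧ W.pt 0 = D.pt 0 ∧ 
-- earlier Rest2Rigidity (stmt-CriticalPhenomena-7526, replaced 2026-08-15T16:44:35Z -> stmt-CriticalPhenomena-11156): retired by None — ∀ (hex : Literature.Probability.RandomPlanarGeometry.exists_isSLECurve), Literature.Probability.RandomPlanarGeometry.IsSLECurve.map_eq → Literature.Probability.RandomPlanarGeometry.IsSLELaw.hullRestriction_eightThirds → Literature.Probability.RandomPlanarGeometry.Ma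
/-- item stmt-CriticalPhenomena-11310 · crux · rank 4 · open · by planner
why it might fail: The rest(2) resampling kernel must be SLE_{8/3} with ρ = 0 (Werner Prop. 14 at α = 2, 'heuristic, can be made rigorous'); passing from Q-a.e. arcs to EVERY simple wall needs full support of the rest(2) left arc in wall-space (Rest2Support) and SLE wall-continuity (Radó).
sources: Werner2005ConformalRestriction, Werner2004Girsanov, LawlerSchrammWerner2003Restriction, BeffaraPeltolaWu2021, MillerSheffield2016, Lawler2005ConformallyInvariant
[crux] (continuum identification, hypothesis-free; REPAIRED 2026-08-15 per refuter g2 on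
stmt-CriticalPhenomena-7526: wall-continuity of P is ASKED and the conclusion DRAWN at simple walls
only) In a Dobrushin domain D let P assign to every wall η (right wall-domain W: Dobrushin, W ⊆ D,
same marks, ∂W = η ∪ D.arc 1) a law on curves, continuously at simple limit walls (η_n → η in
CurveClass ℂ, η simple ⇒ P η_n ⇒ P η); let Q be a swap-symmetric probability law on pairs of simple,
boundary-avoiding chords a → b, disjoint off {a, b}, such that (Gibbs) conditionally on the first
arc η and on the second lying to its right the second arc has law P η, and (rest(2)) Q[both arcs ⊆
cl D'] = Φ'_A(0)² for every hull subdomain D' = φ(ℍ ∖ A). Then P η is the chordal SLE_{8/3} law of W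
for every SIMPLE wall η. Plan: fill of Q is rest(2) ⇒ Q is THE rest(2) boundary pair (arcs =
boundary of the fill; LSW03 Lemma 3.2 transposed) ⇒ by Rest2Boundary its right-resampling kernel is
SLE_{8/3}(W(η)) ⇒ P η = SLE for Q-a.e. left arc ⇒ at every simple wall by continuity of P and of
SLE_{8/3} (SLEDomainContinuity) and full support of the left arc of two excursions among simple
walls (Rest2Support, layer 2). Th -/
@[route_item "route-CriticalPhenomena-SAWRingGibbsDescent", crux]
def Rest2Rigidity : Prop :=
  ∀ (D : Literature.Probability.RandomPlanarGeometry.DobrushinDomain), (let IsWall : Literature.Probability.RandomPlanarGeometry.CurveClass ℂ → Literature.Probability.RandomPlanarGeometry.DobrushinDomain → Prop := fun η W => W.carrier ⊆ D.carrier ∧ W.pt 0 = D.pt 0 ∧ W.pt 1 = D.pt 1 ∧ frontier W.carrier = η.range ∪ D.arc 1; let Side : Set (Literature.Probability.RandomPlanarGeometry.CurveClass ℂ × Literature.Probability.RandomPlanarGeometry.CurveClass ℂ) := {p | p.2.range ⊆ closure (⋃₀ {U : Set ℂ | IsOpen U ∧ IsConnected U ∧ U ⊆ D.carrier ∧ frontier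 U = p.1.range ∪ D.arc 1})}; ∀ (P : Literature.Probability.RandomPlanarGeometry.CurveClass ℂ → Measure (Literature.Probability.RandomPlanarGeometry.CurveClass ℂ)) (Q : Measure (Literature.Probability.RandomPlanarGeometry.CurveClass ℂ × Literature.Probability.RandomPlanarGeometry.CurveClass ℂ)), (∀ (ηs : ℕ → Literature.Probability.RandomPlanarGeometry.CurveClass ℂ) (η : Literature.Probability.RandomPlanarGeometry.CurveClass ℂ) (Ws : ℕ → Literature.Probability.RandomPlanarGeometry.DobrushinDomain) (W : Literature.Probability.RandomPlanarGeometry.DobrushinDomain), (∀ n, IsWall (ηs n) (Ws n)) → IsWall η W → η ∈ Literature.Probability.RandomPlanarGeometry.CurveClass.simple → Tendsto ηs atTop (nhds η) → ∀ f : BoundedContinuousFunction (Literature.Probability.RandomPlanarGeometry.CurveClass ℂ) ℝ, Tendsto (fun n => ∫ x, f x ∂(P (ηs n))) atTop (nhds (∫ x, f x ∂(P η)))) → IsProbabilityMeasure Q → Q.map Prod.swap = Q → (∀ᵐ p ∂Q, p.1 ∈ Literature.Probability.RandomPlanarGeometry.CurveClass.simple ∧ p.1.source = D.pt 0 ∧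 p.1.target = D.pt 1 ∧ p.1.range ⊆ closure D.carrier ∧ p.1.range ∩ frontier D.carrier ⊆ {D.pt 0, D.pt 1} ∧ p.1.range ∩ p.2.range ⊆ {D.pt 0, D.pt 1}) → (∀ E F : Set (Literature.Probability.RandomPlanarGeometry.CurveClass ℂ), MeasurableSet E → MeasurableSet F → Q ((E ×ˢ F) ∩ Side) = ∫⁻ η in E, P η F ∂((Q.restrict Side).map Prod.fst)) → (∀ D' : Literature.Probability.RandomPlanarGeometry.DobrushinDomain, (D'.carrier ⊆ D.carrier ∧ D'.pt 0 = D.pt 0 ∧ D'.pt 1 = D.pt 1 ∧ D.pt 0 ∉ closure (D.carrier \ D'.carrier) ∧ D.pt 1 ∉ closure (D.carrier \ D'.carrier)) → ∀ φ : Literature.Probability.RandomPlanarGeometry.ConformalEquiv UpperHalfPlane.upperHalfPlaneSet D.carrier, D.IsChordalUniformizing φ → ∀ A : Set ℂ, A = closure (UpperHalfPlane.upperHalfPlaneSet \ {z : ℂ | z ∈ UpperHalfPlane.upperHalfPlaneSet ∧ φ z ∈ D'.carrier}) → ∀ Φ : Literature.Probability.RandomPlanarGeometry.ConformalEquiv (UpperHalfPlane.upperHalfPlaneSet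 \ A) UpperHalfPlane.upperHalfPlaneSet, Literature.Probability.RandomPlanarGeometry.IsRestrictionMap A Φ → ∀ d : ℝ, Literature.Probability.RandomPlanarGeometry.HasRestrictionDeriv A Φ d → Q {p : Literature.Probability.RandomPlanarGeometry.CurveClass ℂ × Literature.Probability.RandomPlanarGeometry.CurveClass ℂ | p.1.range ⊆ closure D'.carrier ∧ p.2.range ⊆ closure D'.carrier} = ENNReal.ofReal (d ^ 2)) → ∀ (η : Literature.Probability.RandomPlanarGeometry.CurveClass ℂ) (W : Literature.Probability.RandomPlanarGeometry.DobrushinDomain), IsWall η W → η ∈ Literature.Probability.RandomPlanarGeometry.CurveClass.simple → Literature.Probability.RandomPlanarGeometry.IsSLELaw ((8 : NNReal) / 3) W (P η))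

/-- item stmt-CriticalPhenomena-7527 · crux · rank 5 · open · by planner
why it might fail: Tightness of critical SAW strands is open (no annulus-crossing bound at x_c in print), and macroscopic self- /mutual touching of the two strands through microscopic bottlenecks must have vanishing probability — a two-strand no-pinching estimate not in print (DCKY Problem 10 nearby).
sources: LawlerSchrammWerner2004SAW, DuminilCopinKozmaYadin2014, KennedyLawler2013, AizenmanBurchard1999, KemppainenSmirnov2017
[crux] (card K3 'SetsToCurves', ring form) For every Dobrushin domain and every ring-reachable
endpoint approximation, the ring's arc pair laws (pushed to CurveClass ℂ × CurveClass ℂ) are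
EVENTUALLY TIGHT (∃ δ₀; two-strand Aizenman–Burchard / Kemppainen–Smirnov bounds; eventual form, cf.
the refuted all-δ stmt-CriticalPhenomena-0772) and every subsequential weak limit Q is carried by
pairs of SIMPLE chords from a to b in cl D that meet ∂D only at a, b and each other only at a, b.
[difficulty: L] -/
@[route_item "route-CriticalPhenomena-SAWRingGibbsDescent", crux]
def RingLimitArcs : Prop :=
  ∀ (D : Literature.Probability.RandomPlanarGeometry.DobrushinDomain) (a b : ℝ → Literature.Probability.LatticeModels.Site 2), Literature.Probability.RandomPlanarGeometry.SAW.IsEndpointApprox D a b → (∀ᶠ δ in nhdsWithin (0 : ℝ) (Set.Ioi 0), ∃ p : Literature.Probability.RandomPlanarGeometry.SAW.DomainSAW D.carrier δ (a δ) (b δ) × Literature.Probability.RandomPlanarGeometry.SAW.DomainSAW D.carrier δ (a δ) (b δ), ∀ v, v ∈ p.1.walk.support → v ∈ p.2.walk.support → v = a δ ∨ v = b δ) → (let ring : (δ : ℝ) → MeasureTheory.Measure (Literature.Probability.RandomPlanarGeometry.SAW.DomainSAW D.carrier δ (a δ) (b δ) × Literature.Probability.RandomPlanarGeometry.SAW.DomainSAW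 D.carrier δ (a δ) (b δ)) := fun δ => (let R : MeasureTheory.Measure (Literature.Probability.RandomPlanarGeometry.SAW.DomainSAW D.carrier δ (a δ) (b δ) × Literature.Probability.RandomPlanarGeometry.SAW.DomainSAW D.carrier δ (a δ) (b δ)) := ((Literature.Probability.RandomPlanarGeometry.SAW.weight D.carrier δ (a δ) (b δ)).prod (Literature.Probability.RandomPlanarGeometry.SAW.weight D.carrier δ (a δ) (b δ))).restrict {p : Literature.Probability.RandomPlanarGeometry.SAW.DomainSAW D.carrier δ (a δ) (b δ) × Literature.Probability.RandomPlanarGeometry.SAW.DomainSAW D.carrier δ (a δ) (b δ) | ∀ v, v ∈ p.1.walk.support → v ∈ p.2.walk.support → v = (a δ) ∨ v = (b δ)}; (R Set.univ)⁻¹ • R); (∃ δ₀ : ℝ, 0 < δ₀ ∧ MeasureTheory.IsTightMeasureSet ((fun δ => (ring δ).map (fun p => (p.1.curve, p.2.curve))) '' Set.Ioc 0 δ₀)) ∧ ∀ (s : ℕ → ℝ) (Q : MeasureTheory.Measure (Literature.Probability.RandomPlanarGeometry.CurveClass ℂ × Literature.Probability.RandomPlanarGeometry.CurveClass ℂ)),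 Filter.Tendsto s Filter.atTop (nhdsWithin 0 (Set.Ioi 0)) → MeasureTheory.IsProbabilityMeasure Q → (∀ f : BoundedContinuousFunction (Literature.Probability.RandomPlanarGeometry.CurveClass ℂ × Literature.Probability.RandomPlanarGeometry.CurveClass ℂ) ℝ, Filter.Tendsto (fun n => ∫ p, f (p.1.curve, p.2.curve) ∂(ring (s n))) Filter.atTop (nhds (∫ x, f x ∂Q))) → (∀ᵐ p ∂Q, p.1 ∈ Literature.Probability.RandomPlanarGeometry.CurveClass.simple ∧ p.2 ∈ Literature.Probability.RandomPlanarGeometry.CurveClass.simple ∧ p.1.source = D.pt 0 ∧ p.1.target = D.pt 1 ∧ p.2.source = D.pt 0 ∧ p.2.target = D.pt 1 ∧ p.1.range ⊆ closure D.carrier ∧ p.2.range ⊆ closure D.carrier ∧ p.1.range ∩ frontier D.carrier ⊆ {D.pt 0, D.pt 1} ∧ p.2.range ∩ frontier D.carrier ⊆ {D.pt 0, D.pt 1} ∧ p.1.range ∩ p.2.range ⊆ {D.pt 0, D.pt 1}))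

-- earlier GibbsDescent (stmt-CriticalPhenomena-7528, replaced 2026-08-15T16:44:35Z -> stmt-CriticalPhenomena-11157): retired by None — RingSquaredExcursion → DomainContinuity → Rest2Rigidity → RingLimitArcs → (∀ (D D' : Literature.Probability.RandomPlanarGeometry.DobrushinDomain) (a b : ℝ → Literature.Probability.LatticeModels.Site 2), Literature.Probability.RandomPlanarGeometry.SAW.IsEndpointApprox
/-- item stmt-CriticalPhenomena-11278 · crux · rank 6 · open · by planner
why it might fail: Passing the singular conditioning 'given the left arc' to the limit needs equicontinuity of slit-domain SAW laws exactly at rough lattice walls with pins on the wall (end-edge surgery, largest-component pockets); a gap there forces an averaged, hull-conditioned descent instead.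
sources: LawlerSchrammWerner2004SAW, MadrasSlade1993, BeffaraPeltolaWu2021, Billingsley1999, KozdronLawler2005
[crux] (card 'descent': the walk is the ring seen from one arc; rev 2: no fact antecedents — all
discharged in the tree — so the deciding theorem feeds its output straight into Assembly)
RingSquaredExcursion → DomainContinuity → Rest2Rigidity → RingLimitArcs → ExcursionRatio →
EventualTight → SubseqIdentification (the last three inlined verbatim, supports being declared after
cruxes): for ANY endpoint approximation of (D; a, b), every subsequential weak limit μ of the
critical SAW laws along s_n → 0⁺ is the chordal SLE_{8/3} law. Plan: bulge D across arc 0 to D⁺ so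
that D is the right wall-domain of η₀ = D.arc 0; along a subsequence extract the ring pair limit Q
in D⁺ (tightness half of RingLimitArcs) and SAW limits P η in wall-domains (EventualTight on a dense
countable set + DomainContinuity); the EXACT lattice Gibbs property (given γ₁ and its side, γ₂ minus
its two end-edges is the x_c-SAW of the slit graph between neighbours of the pins) passes to the
limit as the resampling identity because DomainContinuity is kernel equicontinuity;
RingSquaredExcursion + ExcursionRatio + portmanteau + kernel continuity
(HasRestrictionDeriv.tendsto_of_kernel_holds) give the rest(2) fill; RingL -/
@[route_item "route-CriticalPhenomena-SAWRingGibbsDescent", crux]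
def GibbsDescent : Prop :=
  RingSquaredExcursion → DomainContinuity → Rest2Rigidity → RingLimitArcs → (∀ (D D' : Literature.Probability.RandomPlanarGeometry.DobrushinDomain) (a b : ℝ → Literature.Probability.LatticeModels.Site 2), Literature.Probability.RandomPlanarGeometry.SAW.IsEndpointApprox D a b → (D'.carrier ⊆ D.carrier ∧ D'.pt 0 = D.pt 0 ∧ D'.pt 1 = D.pt 1 ∧ D.pt 0 ∉ closure (D.carrier \ D'.carrier) ∧ D.pt 1 ∉ closure (D.carrier \ D'.carrier)) → ∀ φ : Literature.Probability.RandomPlanarGeometry.ConformalEquiv UpperHalfPlane.upperHalfPlaneSet D.carrier, D.IsChordalUniformizing φ → ∀ A : Set ℂ, A = closure (UpperHalfPlane.upperHalfPlaneSet \ {z : ℂ | z ∈ UpperHalfPlane.upperHalfPlaneSet ∧ φ z ∈ D'.carrier}) → ∀ Φ : Literature.Probability.RandomPlanarGeometry.ConformalEquiv (UpperHalfPlane.upperHalfPlaneSet \ A) UpperHalfPlane.upperHalfPlaneSet, Literature.Probability.RandomPlanarGeometry.IsRestrictionMap A Φ → ∀ d : ℝ, Literature.Probability.RandomPlanarGeometry.HasRestrictionDeriv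 A Φ d → (let exc : (δ : ℝ) → Set ℂ → ENNReal := fun δ S => ∑' ω : (Literature.Probability.LatticeModels.discreteDomainGraph D.carrier δ).Walk (a δ) (b δ), Set.indicator {ω | ω.support.count (b δ) = 1 ∧ Literature.Probability.RandomPlanarGeometry.CurveClass.mk (⟨ω.toCurve (Literature.Probability.LatticeModels.meshPoint δ)⟩ : Literature.Probability.RandomPlanarGeometry.Curve ℂ) ∈ Literature.Probability.RandomPlanarGeometry.CurveClass.rangeSubset S} (fun ω => (4 : ENNReal)⁻¹ ^ ω.length) ω; Filter.Tendsto (fun δ => (exc δ (closure D'.carrier) / exc δ Set.univ).toReal) (nhdsWithin 0 (Set.Ioi 0)) (nhds d))) → (∀ (D : Literature.Probability.RandomPlanarGeometry.DobrushinDomain) (a b : ℝ → Literature.Probability.LatticeModels.Site 2), Literature.Probability.RandomPlanarGeometry.SAW.IsEndpointApprox D a b → ∃ δ₀ : ℝ, 0 < δ₀ ∧ MeasureTheory.IsTightMeasureSet ((fun δ => (Literature.Probability.RandomPlanarGeometry.SAW.law D.carrier δ (a δ) (b δ)).map (fun γ => γ.curve)) '' Set.Ioc 0 δ₀)) → ∀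 (D : Literature.Probability.RandomPlanarGeometry.DobrushinDomain) (a b : ℝ → Literature.Probability.LatticeModels.Site 2), Literature.Probability.RandomPlanarGeometry.SAW.IsEndpointApprox D a b → ∀ (s : ℕ → ℝ) (μ : MeasureTheory.Measure (Literature.Probability.RandomPlanarGeometry.CurveClass ℂ)), Filter.Tendsto s Filter.atTop (nhdsWithin 0 (Set.Ioi 0)) → MeasureTheory.IsProbabilityMeasure μ → (∀ f : BoundedContinuousFunction (Literature.Probability.RandomPlanarGeometry.CurveClass ℂ) ℝ, Filter.Tendsto (fun n => ∫ γ, f γ.curve ∂(Literature.Probability.RandomPlanarGeometry.SAW.law D.carrier (s n) (a (s n)) (b (s n)))) Filter.atTop (nhds (∫ x, f x ∂μ))) → Literature.Probability.RandomPlanarGeometry.IsSLELaw ((8 : NNReal) / 3) D μ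

/-- item stmt-CriticalPhenomena-17607 · crux · rank 7 · open · by planner
why it might fail: It is uniform-in-δ no-hugging of ROUGH simple limit walls: the SAW from deep pins must enter the collar W_n Δ W with probability → 0 uniformly in n ≥ N(s), δ < δ₀(s); nothing of the kind is proved at x_c (sub-ballisticity is far weaker); thin finite-n fjords could carry mass.
sources: DuminilCopinHammond2013, LawlerSchrammWerner2004SAW, KennedyLawler2013, MadrasSlade1993
[crux] (child 2/3 of DomainContinuity, line common-pin-triangle = NoHugging at common deep pins)
Same frame (D, η_n → η simple, W_n, W). For every bounded continuous f and ε > 0 there is ρ > 0 such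
that for every depth s > 0 there are N, δ₀ with: for all n ≥ N, δ ∈ (0, δ₀) and lattice pins x
within ρ of a, y within ρ of b whose s-balls lie in W_n ∩ W and which are joined both in (W_n)_δ and
in W_δ, |E f(SAW of W_n at mesh δ from x to y) − E f(SAW of W at mesh δ from x to y)| < ε. Pure wall
sensitivity at FIXED pins: by the exact lattice restriction identity (walks confined to a common
inner domain have the same conditional law in both graphs) it is two collar-exit estimates P_{W_n}[γ
⊄ U] + P_W[γ ⊄ U] → 0, i.e. uniform-in-δ no-hugging of rough simple limit walls. [difficulty: XL] -/
@[route_item "route-CriticalPhenomena-SAWRingGibbsDescent"]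
def CommonPinWallContinuity : Prop :=
  ∀ (D : Literature.Probability.RandomPlanarGeometry.DobrushinDomain), (let IsWall : Literature.Probability.RandomPlanarGeometry.CurveClass ℂ → Literature.Probability.RandomPlanarGeometry.DobrushinDomain → Prop := fun η W => W.carrier ⊆ D.carrier ∧ W.pt 0 = D.pt 0 ∧ W.pt 1 = D.pt 1 ∧ frontier W.carrier = η.range ∪ D.arc 1; ∀ (ηs : ℕ → Literature.Probability.RandomPlanarGeometry.CurveClass ℂ) (η : Literature.Probability.RandomPlanarGeometry.CurveClass ℂ) (Ws : ℕ → Literature.Probability.RandomPlanarGeometry.DobrushinDomain) (W : Literature.Probability.RandomPlanarGeometry.DobrushinDomain), (∀ n, IsWall (ηs n) (Ws n)) → IsWall η W → η ∈ Literature.Probability.RandomPlanarGeometry.CurveClass.simple → Filter.Tendsto ηs Filter.atTop (nhds η) → ∀ f : BoundedContinuousFunction (Literature.Probability.RandomPlanarGeometry.CurveClass ℂ) ℝ, ∀ ε > (0 : ℝ), ∃ ρ : ℝ, 0 < ρ ∧ ∀ s > (0 : ℝ), ∃ N : ℕ, ∃ δ₀ : ℝ, 0 < δ₀ ∧ ∀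 n ≥ N, ∀ δ ∈ Set.Ioo (0 : ℝ) δ₀, ∀ x y : Literature.Probability.LatticeModels.Site 2, dist (Literature.Probability.LatticeModels.meshPoint δ x) (D.pt 0) < ρ → dist (Literature.Probability.LatticeModels.meshPoint δ y) (D.pt 1) < ρ → Metric.ball (Literature.Probability.LatticeModels.meshPoint δ x) s ⊆ (Ws n).carrier ∩ W.carrier → Metric.ball (Literature.Probability.LatticeModels.meshPoint δ y) s ⊆ (Ws n).carrier ∩ W.carrier → (Literature.Probability.LatticeModels.discreteDomainGraph (Ws n).carrier δ).Reachable x y → (Literature.Probability.LatticeModels.discreteDomainGraph W.carrier δ).Reachable x y → |(∫ γ, f γ.curve ∂(Literature.Probability.RandomPlanarGeometry.SAW.law (Ws n).carrier δ x y)) - ∫ γ, f γ.curve ∂(Literature.Probability.RandomPlanarGeometry.SAW.law W.carrier δ x y)| < ε)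

/-- item stmt-CriticalPhenomena-17606 · crux · rank 8 · open · by planner
why it might fail: Pin-insensitivity uniform over interior pins at depth ~ρ and boundary-adjacent pins behind lattice-scale fjords of W_n (same component) may fail: Kennedy–Lawler boundary lattice effects could survive in the normalised LAW, not only in Z; uniform tightness over the wall family is implicit.
sources: KennedyLawler2013, LawlerSchrammWerner2004SAW, MadrasSlade1993, DuminilCopinHammond2013
[crux] (child 1/3 of DomainContinuity, line common-pin-triangle = EndpointLocality in uniform form)
Fix the ambient Dobrushin domain D and walls η_n → η (η simple) with right wall-domains W_n, W as in
DomainContinuity. For every bounded continuous f and ε > 0 there are ρ > 0, N, δ₀ such that for all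
n ≥ N, δ ∈ (0, δ₀) and all lattice pins x, y, x', y' with x, x' within ρ of the mark a = D.pt 0 and
y, y' within ρ of b = D.pt 1, x ~ y, x' ~ y' and x ~ x' joined in the graph of (W_n)_δ: |E f(SAW of
W_n at mesh δ from x to y) − E f(SAW of W_n at mesh δ from x' to y')| < ε. The critical SAW law of
ONE domain forgets which joined pins near the marks are used (interior or boundary-adjacent),
uniformly over the convergent wall family and the mesh; the constant sequence gives the same for W.
Implied by DomainContinuity itself via a diagonal argument (so not stronger than the parent); with
CommonPinWallContinuity and CommonPinsExist it gives the parent back (DomainContinuity_of,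
Cruxes/DomainContinuity/Lines/common_pin_triangle.lean). [difficulty: L] -/
@[route_item "route-CriticalPhenomena-SAWRingGibbsDescent"]
def PinLocality : Prop :=
  ∀ (D : Literature.Probability.RandomPlanarGeometry.DobrushinDomain), (let IsWall : Literature.Probability.RandomPlanarGeometry.CurveClass ℂ → Literature.Probability.RandomPlanarGeometry.DobrushinDomain → Prop := fun η W => W.carrier ⊆ D.carrier ∧ W.pt 0 = D.pt 0 ∧ W.pt 1 = D.pt 1 ∧ frontier W.carrier = η.range ∪ D.arc 1; ∀ (ηs : ℕ → Literature.Probability.RandomPlanarGeometry.CurveClass ℂ) (η : Literature.Probability.RandomPlanarGeometry.CurveClass ℂ) (Ws : ℕ → Literature.Probability.RandomPlanarGeometry.DobrushinDomain) (W : Literature.Probability.RandomPlanarGeometry.DobrushinDomain), (∀ n, IsWall (ηs n) (Ws n)) → IsWall η W → η ∈ Literature.Probability.RandomPlanarGeometry.CurveClass.simple → Filter.Tendsto ηs Filter.atTop (nhds η) → ∀ f : BoundedContinuousFunction (Literature.Probability.RandomPlanarGeometry.CurveClass ℂ) ℝ, ∀ ε > (0 : ℝ), ∃ ρ : ℝ,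 0 < ρ ∧ ∃ N : ℕ, ∃ δ₀ : ℝ, 0 < δ₀ ∧ ∀ n ≥ N, ∀ δ ∈ Set.Ioo (0 : ℝ) δ₀, ∀ x y x' y' : Literature.Probability.LatticeModels.Site 2, dist (Literature.Probability.LatticeModels.meshPoint δ x) (D.pt 0) < ρ → dist (Literature.Probability.LatticeModels.meshPoint δ y) (D.pt 1) < ρ → dist (Literature.Probability.LatticeModels.meshPoint δ x') (D.pt 0) < ρ → dist (Literature.Probability.LatticeModels.meshPoint δ y') (D.pt 1) < ρ → (Literature.Probability.LatticeModels.discreteDomainGraph (Ws n).carrier δ).Reachable x y → (Literature.Probability.LatticeModels.discreteDomainGraph (Ws n).carrier δ).Reachable x' y' → (Literature.Probability.LatticeModels.discreteDomainGraph (Ws n).carrier δ).Reachable x x' → |(∫ γ, f γ.curve ∂(Literature.Probability.RandomPlanarGeometry.SAW.law (Ws n).carrier δ x y)) - ∫ γ, f γ.curve ∂(Literature.Probability.RandomPlanarGeometry.SAW.law (Ws n).carrier δ x' y')| < ε)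

/-- item stmt-CriticalPhenomena-0783 · support · rank 9 · open · by planner
sources: LawlerSchrammWerner2004SAW, LawlerSchrammWerner2003Restriction
[crux] r3: identification of subsequential limits — for every Dobrushin domain D, endpoint
approximation (a_δ,b_δ), sequence s_n → 0+ and probability measure μ on CurveClass ℂ, if ∫ f∘curve
d(Literature.Probability.RandomPlanarGeometry.SAW.law D (s n) …) → ∫ f dμ for all bounded continuous
f then μ is the chordal SLE_{8/3} law in D (Literature.Probability.RandomPlanarGeometry.IsSLELaw
(8/3) D μ). Obtained from r2 (observable limit) by the martingale principle (LSW03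
arXiv:math/0209343 Prop. 5.2: κ = 8/3 is singled out by the 5/8-observable), or from restriction
(sibling route). -/
@[route_item "route-CriticalPhenomena-SAWRingGibbsDescent", crux]
def SubseqIdentification : Prop :=
  ∀ (D : Literature.Probability.RandomPlanarGeometry.DobrushinDomain) (a b : ℝ → Literature.Probability.LatticeModels.Site 2), Literature.Probability.RandomPlanarGeometry.SAW.IsEndpointApprox D a b → ∀ (s : ℕ → ℝ) (μ : MeasureTheory.Measure (Literature.Probability.RandomPlanarGeometry.CurveClass ℂ)), Filter.Tendsto s Filter.atTop (nhdsWithin 0 (Set.Ioi 0)) → MeasureTheory.IsProbabilityMeasure μ → (∀ f : BoundedContinuousFunction (Literature.Probability.RandomPlanarGeometry.CurveClass ℂ) ℝ, Filter.Tendsto (fun n => ∫ γ, f γ.curve ∂(Literature.Probability.RandomPlanarGeometry.SAW.law D.carrier (s n) (a (s n)) (b (s n)))) Filter.atTop (nhds (∫ x, f x ∂μ))) → Literature.Probability.RandomPlanarGeometry.IsSLELaw ((8 : NNReal) / 3) D μ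

-- earlier Rest2Boundary (stmt-CriticalPhenomena-7529, replaced 2026-08-15T16:44:35Z -> stmt-CriticalPhenomena-11158): retired by None — ∀ (hex : Literature.Probability.RandomPlanarGeometry.exists_isSLECurve), Literature.Probability.RandomPlanarGeometry.IsSLECurve.map_eq → Literature.Probability.RandomPlanarGeometry.IsSLELaw.hullRestriction_eightThirds → Literature.Probability.RandomPlanarGeometry.Ma
/-- item stmt-CriticalPhenomena-11279 · support · rank 9 · open · by planner
sources: Werner2005ConformalRestriction, Werner2004Girsanov, Lawler2005ConformallyInvariant, LawlerSchrammWerner2003Restriction, Wu2015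
[support] (continuum; Werner arXiv:math/0307353 Prop. 14 at α = 2, made rigorous; rev 2: no fact
antecedents, and 'the second arc is SLE_{8/3} of the wall-domain' is stated for ANY kernel P with
IsSLELaw (8/3) (S η) (P η) on E instead of sleEightThirdsFamily hex — the SLE_{8/3} law of a
Dobrushin domain exists and is unique: exists_isSLECurve_eightThirds, IsSLECurve.map_eq_holds) Every
swap-symmetric probability law Q on pairs of simple, disjoint, boundary-avoiding chords of (D; a, b)
whose fill has the rest(2) avoidance law Q[both ⊆ cl D'] = Φ'_A(0)² (A = closure(ℍ ∖ φ⁻¹D') written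
out) has the SLE_{8/3} right-resampling property: conditionally on the first arc η and on the second
lying to its right, the second is chordal SLE_{8/3} of the right wall-domain of η. Contains:
uniqueness of such Q (arcs = boundary of the fill, LSW03 Lemma 3.2 transposed) and the
identification of the rest(2) boundary pair with 'SLE_{8/3}(2), then SLE_{8/3} in the complement'
(Lawler 2005 Cor. 9.18: right boundary of the fill of k = 2 excursions is SLE(8/3, 2)). [difficulty:
L] -/
@[route_item "route-CriticalPhenomena-SAWRingGibbsDescent", crux]
def Rest2Boundary : Prop :=
  ∀ (D : Literature.Probability.RandomPlanarGeometry.DobrushinDomain), (let IsWall : Literature.Probability.RandomPlanarGeometry.CurveClass ℂ → Literature.Probability.RandomPlanarGeometry.DobrushinDomain → Prop := fun η W => W.carrier ⊆ D.carrier ∧ W.pt 0 = D.pt 0 ∧ W.pt 1 = D.pt 1 ∧ frontier W.carrier = η.range ∪ D.arc 1; let Side : Set (Literature.Probability.RandomPlanarGeometry.CurveClass ℂ × Literature.Probability.RandomPlanarGeometry.CurveClass ℂ) := {p | p.2.range ⊆ closure (⋃₀ {U : Set ℂ | IsOpen U ∧ IsConnected U ∧ U ⊆ D.carrier ∧ frontier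 U = p.1.range ∪ D.arc 1})}; ∀ (Q : MeasureTheory.Measure (Literature.Probability.RandomPlanarGeometry.CurveClass ℂ × Literature.Probability.RandomPlanarGeometry.CurveClass ℂ)), MeasureTheory.IsProbabilityMeasure Q → Q.map Prod.swap = Q → (∀ᵐ p ∂Q, p.1 ∈ Literature.Probability.RandomPlanarGeometry.CurveClass.simple ∧ p.1.source = D.pt 0 ∧ p.1.target = D.pt 1 ∧ p.1.range ⊆ closure D.carrier ∧ p.1.range ∩ frontier D.carrier ⊆ {D.pt 0, D.pt 1} ∧ p.1.range ∩ p.2.range ⊆ {D.pt 0, D.pt 1}) → (∀ D' : Literature.Probability.RandomPlanarGeometry.DobrushinDomain, (D'.carrier ⊆ D.carrier ∧ D'.pt 0 = D.pt 0 ∧ D'.pt 1 = D.pt 1 ∧ D.pt 0 ∉ closure (D.carrier \ D'.carrier) ∧ D.pt 1 ∉ closure (D.carrier \ D'.carrier)) → ∀ φ : Literature.Probability.RandomPlanarGeometry.ConformalEquiv UpperHalfPlane.upperHalfPlaneSet D.carrier, D.IsChordalUniformizing φ → ∀ A : Set ℂ, A = closure (UpperHalfPlane.upperHalfPlaneSet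 \ {z : ℂ | z ∈ UpperHalfPlane.upperHalfPlaneSet ∧ φ z ∈ D'.carrier}) → ∀ Φ : Literature.Probability.RandomPlanarGeometry.ConformalEquiv (UpperHalfPlane.upperHalfPlaneSet \ A) UpperHalfPlane.upperHalfPlaneSet, Literature.Probability.RandomPlanarGeometry.IsRestrictionMap A Φ → ∀ d : ℝ, Literature.Probability.RandomPlanarGeometry.HasRestrictionDeriv A Φ d → Q {p : Literature.Probability.RandomPlanarGeometry.CurveClass ℂ × Literature.Probability.RandomPlanarGeometry.CurveClass ℂ | p.1.range ⊆ closure D'.carrier ∧ p.2.range ⊆ closure D'.carrier} = ENNReal.ofReal (d ^ 2)) → (∀ E F : Set (Literature.Probability.RandomPlanarGeometry.CurveClass ℂ), MeasurableSet E → MeasurableSet F → ∀ S : Literature.Probability.RandomPlanarGeometry.CurveClass ℂ → Literature.Probability.RandomPlanarGeometry.DobrushinDomain, (∀ η ∈ E, IsWall η (S η)) → ∀ P : Literature.Probability.RandomPlanarGeometry.CurveClass ℂ → MeasureTheory.Measure (Literature.Probability.RandomPlanarGeometry.CurveClass ℂ), (∀ η ∈ E, Literature.Probability.RandomPlanarGeometry.IsSLELaw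 ((8 : NNReal) / 3) (S η) (P η)) → Q ((E ×ˢ F) ∩ Side) = ∫⁻ η in E, P η F ∂((Q.restrict Side).map Prod.fst)))

-- earlier ExcursionRatio (stmt-CriticalPhenomena-7531, replaced 2026-08-15T16:44:35Z -> stmt-CriticalPhenomena-11160): retired by None — ∀ (D D' : Literature.Probability.RandomPlanarGeometry.DobrushinDomain) (a b : ℝ → Literature.Probability.LatticeModels.Site 2), Literature.Probability.RandomPlanarGeometry.SAW.IsEndpointApprox D a b → D.IsHullSubdomain D' → ∀ φ : Literature.Probability.RandomPlanar
/-- item stmt-CriticalPhenomena-11281 · support · rank 9 · open · by planner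
sources: KozdronLawler2005, LawlerSchrammWerner2003Restriction, YadinYehudayoff2011, LawlerLimic2010
[support] (card P-item; invariance principle for excursions; rev 2: hull subdomain and pulled-back
hull A = closure(ℍ ∖ {z ∈ ℍ | φ z ∈ D'}) = ConformalEquiv.pullbackHull φ D' written out, so only
RestrictionHulls is imported) For D, a hull subdomain D', an endpoint approximation, a chordal
uniformizer φ of D, the restriction map Φ_A of A (IsRestrictionMap) and d = Φ'_A(0)
(HasRestrictionDeriv): P^exc_δ[ω ⊆ cl D'] → d, i.e. the discrete excursion a_δ → b_δ of Ω_δ (as in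
RingSquaredExcursion) stays in cl D' with probability tending to the Brownian excursion's (LSW03
Prop. 4.1: the excursion avoids A with probability Φ'_A(0)). [difficulty: M] -/
@[route_item "route-CriticalPhenomena-SAWRingGibbsDescent", crux]
def ExcursionRatio : Prop :=
  ∀ (D D' : Literature.Probability.RandomPlanarGeometry.DobrushinDomain) (a b : ℝ → Literature.Probability.LatticeModels.Site 2), Literature.Probability.RandomPlanarGeometry.SAW.IsEndpointApprox D a b → (D'.carrier ⊆ D.carrier ∧ D'.pt 0 = D.pt 0 ∧ D'.pt 1 = D.pt 1 ∧ D.pt 0 ∉ closure (D.carrier \ D'.carrier) ∧ D.pt 1 ∉ closure (D.carrier \ D'.carrier)) → ∀ φ : Literature.Probability.RandomPlanarGeometry.ConformalEquiv UpperHalfPlane.upperHalfPlaneSet D.carrier, D.IsChordalUniformizing φ → ∀ A : Set ℂ, A = closure (UpperHalfPlane.upperHalfPlaneSet \ {z : ℂ | z ∈ UpperHalfPlane.upperHalfPlaneSet ∧ φ z ∈ D'.carrier}) → ∀ Φ : Literature.Probability.RandomPlanarGeometry.ConformalEquiv (UpperHalfPlane.upperHalfPlaneSet \ A) UpperHalfPlane.upperHalfPlaneSet,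 Literature.Probability.RandomPlanarGeometry.IsRestrictionMap A Φ → ∀ d : ℝ, Literature.Probability.RandomPlanarGeometry.HasRestrictionDeriv A Φ d → (let exc : (δ : ℝ) → Set ℂ → ENNReal := fun δ S => ∑' ω : (Literature.Probability.LatticeModels.discreteDomainGraph D.carrier δ).Walk (a δ) (b δ), Set.indicator {ω | ω.support.count (b δ) = 1 ∧ Literature.Probability.RandomPlanarGeometry.CurveClass.mk (⟨ω.toCurve (Literature.Probability.LatticeModels.meshPoint δ)⟩ : Literature.Probability.RandomPlanarGeometry.Curve ℂ) ∈ Literature.Probability.RandomPlanarGeometry.CurveClass.rangeSubset S} (fun ω => (4 : ENNReal)⁻¹ ^ ω.length) ω; Filter.Tendsto (fun δ => (exc δ (closure D'.carrier) / exc δ Set.univ).toReal) (nhdsWithin 0 (Set.Ioi 0)) (nhds d))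

-- earlier SLEDomainContinuity (stmt-CriticalPhenomena-11280, replaced 2026-08-15T17:01:22Z -> stmt-CriticalPhenomena-11311): retired by None — ∀ (D : Literature.Probability.RandomPlanarGeometry.DobrushinDomain), (let IsWall : Literature.Probability.RandomPlanarGeometry.CurveClass ℂ → Literature.Probability.RandomPlanarGeometry.DobrushinDomain → Prop := fun η W => W.carrier ⊆ D.carrier ∧ W.pt 0 = D.p
-- earlier SLEDomainContinuity (stmt-CriticalPhenomena-7530, replaced 2026-08-15T16:44:35Z -> stmt-CriticalPhenomena-11159): retired by None — ∀ (hex : Literature.Probability.RandomPlanarGeometry.exists_isSLECurve), Literature.Probability.RandomPlanarGeometry.IsSLECurve.map_eq → Literature.Probability.RandomPlanarGeometry.IsSLELaw.hullRestriction_eightThirds → Literature.Probability.RandomPlanarGeome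
/-- item stmt-CriticalPhenomena-11311 · support · rank 9 · open · by planner
sources: PommerenkeBBCM1992, RohdeSchramm2005, LawlerSchrammWerner2003Restriction, Lawler2005ConformallyInvariant
[support] (REPAIRED 2026-08-15 per refuter g2 on stmt-CriticalPhenomena-7530: simple limit wall) In
every Dobrushin domain D the chordal SLE_{8/3} laws of right wall-domains W_n, W with walls η_n → η
in CurveClass ℂ, η SIMPLE, marks fixed, converge weakly. Route: η simple forces ∂W_n → ∂W in the
Fréchet sense, so Radó's theorem (normalised Riemann maps onto Jordan domains converge uniformly on
the closed disc when the boundary curves converge as curves; PommerenkeBBCM1992 §2.4, cite request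
filed) applies, with IsSLECurve = boundary-extension image of the half-plane trace; away from the
marks also by restriction (IsSLELaw.hullRestriction_eightThirds_holds) + kernel continuity of
Φ'_A(0). Non-injective limit walls (collapsed fjords, where only Carathéodory kernel convergence
survives) are excluded on purpose. [difficulty: M] -/
@[route_item "route-CriticalPhenomena-SAWRingGibbsDescent", crux]
def SLEDomainContinuity : Prop :=
  ∀ (D : Literature.Probability.RandomPlanarGeometry.DobrushinDomain), (let IsWall : Literature.Probability.RandomPlanarGeometry.CurveClass ℂ → Literature.Probability.RandomPlanarGeometry.DobrushinDomain → Prop := fun η W => W.carrier ⊆ D.carrier ∧ W.pt 0 = D.pt 0 ∧ W.pt 1 = D.pt 1 ∧ frontier W.carrier = η.range ∪ D.arc 1; (∀ (ηs : ℕ → Literature.Probability.RandomPlanarGeometry.CurveClass ℂ) (η : Literature.Probability.RandomPlanarGeometry.CurveClass ℂ) (Ws : ℕ → Literature.Probability.RandomPlanarGeometry.DobrushinDomain) (W : Literature.Probability.RandomPlanarGeometry.DobrushinDomain), (∀ n, IsWall (ηs n) (Ws n)) → IsWall η W → η ∈ Literature.Probability.RandomPlanarGeometry.CurveClass.simple →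 Tendsto ηs atTop (nhds η) → ∀ (μs : ℕ → MeasureTheory.Measure (Literature.Probability.RandomPlanarGeometry.CurveClass ℂ)) (μ : MeasureTheory.Measure (Literature.Probability.RandomPlanarGeometry.CurveClass ℂ)), (∀ n, Literature.Probability.RandomPlanarGeometry.IsSLELaw ((8 : NNReal) / 3) (Ws n) (μs n)) → Literature.Probability.RandomPlanarGeometry.IsSLELaw ((8 : NNReal) / 3) W μ → ∀ f : BoundedContinuousFunction (Literature.Probability.RandomPlanarGeometry.CurveClass ℂ) ℝ, Tendsto (fun n => ∫ x, f x ∂(μs n)) atTop (nhds (∫ x, f x ∂μ))))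

/-- item stmt-CriticalPhenomena-1372 · support · rank 9 · open · by planner
sources: KemppainenSmirnov2017, AizenmanBurchard1999, DuminilCopinHammond2013
[support] eventual tightness of the pushed-forward critical SAW laws: for every Dobrushin domain and
endpoint approximation there is δ₀ > 0 such that {(law D δ a_δ b_δ).map curve : δ ∈ (0, δ₀]} is a
tight set of measures on CurveClass ℂ — the repaired (∃ δ₀) form of the refuted all-δ statement
stmt-CriticalPhenomena-0772 suggested by its refutation; child-designate of LimitExists, shared need
of every SAW route. Intended tools: Aizenman–Burchard / Kemppainen–Smirnov Condition G2 (an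
annulus-crossing bound at x_c not in print). Sources: KemppainenSmirnov2017 Thm 1.5,
AizenmanBurchardDuke1999, DuminilCopinHammond2013. -/
@[route_item "route-CriticalPhenomena-SAWRingGibbsDescent", crux]
def EventualTight : Prop :=
  ∀ (D : Literature.Probability.RandomPlanarGeometry.DobrushinDomain) (a b : ℝ → Literature.Probability.LatticeModels.Site 2), Literature.Probability.RandomPlanarGeometry.SAW.IsEndpointApprox D a b → ∃ δ₀ : ℝ, 0 < δ₀ ∧ MeasureTheory.IsTightMeasureSet ((fun δ => (Literature.Probability.RandomPlanarGeometry.SAW.law D.carrier δ (a δ) (b δ)).map (fun γ => γ.curve)) '' Set.Ioc 0 δ₀)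

/-- item stmt-CriticalPhenomena-17608 · support · rank 9 · open · by planner
sources: PommerenkeBBCM1992, Beffara2008
[support] (child 3/3 of DomainContinuity, line common-pin-triangle; planar topology of Jordan
wall-domains + lattice approximation, no SAW) Same frame. For every ρ > 0 there are a trigger radius
ρ' > 0, a depth s > 0, N and δ₀ such that for all n ≥ N, δ ∈ (0, δ₀): whenever (x, y) is a pin pair
within ρ' of the marks joined in (W_n)_δ and (x', y') one joined in W_δ, there is a COMMON pin pair
(c, d) within ρ of the marks whose s-balls lie in W_n ∩ W, joined to each other in both graphs, with
x ~ c in (W_n)_δ and x' ~ c in W_δ. Mechanism: Fréchet convergence of the walls to a simple limit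
wall forbids macroscopic back-tracking of ∂W_n, so for n ≥ N, δ < δ₀ the lattice graph of W_n has a
single macroscopic body containing the t-interior of W near a fixed bulk path (winding-number /
Carathéodory-kernel argument), and every joined pin pair near the two marks lies in it. [difficulty:
M] -/
@[route_item "route-CriticalPhenomena-SAWRingGibbsDescent"]
def CommonPinsExist : Prop :=
  ∀ (D : Literature.Probability.RandomPlanarGeometry.DobrushinDomain), (let IsWall : Literature.Probability.RandomPlanarGeometry.CurveClass ℂ → Literature.Probability.RandomPlanarGeometry.DobrushinDomain → Prop := fun η W => W.carrier ⊆ D.carrier ∧ W.pt 0 = D.pt 0 ∧ W.pt 1 = D.pt 1 ∧ frontier W.carrier = η.range ∪ D.arc 1; ∀ (ηs : ℕ → Literature.Probability.RandomPlanarGeometry.CurveClass ℂ) (η : Literature.Probability.RandomPlanarGeometry.CurveClass ℂ) (Ws : ℕ → Literature.Probability.RandomPlanarGeometry.DobrushinDomain) (W : Literature.Probability.RandomPlanarGeometry.DobrushinDomain), (∀ n, IsWall (ηs n) (Ws n)) → IsWall η W → η ∈ Literature.Probability.RandomPlanarGeometry.CurveClass.simple → Filter.Tendsto ηs Filter.atTop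 (nhds η) → ∀ ρ > (0 : ℝ), ∃ ρ' : ℝ, 0 < ρ' ∧ ∃ s : ℝ, 0 < s ∧ ∃ N : ℕ, ∃ δ₀ : ℝ, 0 < δ₀ ∧ ∀ n ≥ N, ∀ δ ∈ Set.Ioo (0 : ℝ) δ₀, ∀ x y x' y' : Literature.Probability.LatticeModels.Site 2, dist (Literature.Probability.LatticeModels.meshPoint δ x) (D.pt 0) < ρ' → dist (Literature.Probability.LatticeModels.meshPoint δ y) (D.pt 1) < ρ' → dist (Literature.Probability.LatticeModels.meshPoint δ x') (D.pt 0) < ρ' → dist (Literature.Probability.LatticeModels.meshPoint δ y') (D.pt 1) < ρ' → (Literature.Probability.LatticeModels.discreteDomainGraph (Ws n).carrier δ).Reachable x y → (Literature.Probability.LatticeModels.discreteDomainGraph W.carrier δ).Reachable x' y' → ∃ c d : Literature.Probability.LatticeModels.Site 2, dist (Literature.Probability.LatticeModels.meshPoint δ c) (D.pt 0) < ρ ∧ dist (Literature.Probability.LatticeModels.meshPoint δ d) (D.pt 1) < ρ ∧ Metric.ball (Literature.Probability.LatticeModels.meshPoint δ c) s ⊆ (Ws n).carrier ∩ W.carrier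 ∧ Metric.ball (Literature.Probability.LatticeModels.meshPoint δ d) s ⊆ (Ws n).carrier ∩ W.carrier ∧ (Literature.Probability.LatticeModels.discreteDomainGraph (Ws n).carrier δ).Reachable x c ∧ (Literature.Probability.LatticeModels.discreteDomainGraph (Ws n).carrier δ).Reachable c d ∧ (Literature.Probability.LatticeModels.discreteDomainGraph W.carrier δ).Reachable x' c ∧ (Literature.Probability.LatticeModels.discreteDomainGraph W.carrier δ).Reachable c d)

/-- item stmt-CriticalPhenomena-17609 · support · rank 9 · open · by planner
sources: folklore
[support] (glue of the typed decomposition of DomainContinuity, line common-pin-triangle; PROVED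
sorry-free as `DomainContinuity_of` in Cruxes/DomainContinuity/Lines/common_pin_triangle.lean, ~90
tactic lines, skeleton OK — a Theorems copy closes this item) ε/3 through a common deep anchor pin
pair (c, d): PinLocality inside W_n moves the given pins to the anchors, CommonPinWallContinuity
crosses from W_n to W at the anchors, PinLocality along the constant wall sequence W moves the
anchors to the IsEndpointApprox pins; the anchors come from CommonPinsExist, triggered once all pins
are within the trigger radius (eventual closeness extracted from 𝓝[>]0), radii threaded ρ ≤ ρ₁ ∧ ρ ≤
ρ₂ ∧ ρ ≤ ρ₃, σ ≤ ρ' ∧ σ ≤ ρ₁ ∧ σ ≤ ρ₂. Filed as an item (not `route edit --split`) because the split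
verb is reserved to a seat's final cycle; with it DomainContinuity is derived from the three pieces.
[deps: PinLocality, CommonPinWallContinuity, CommonPinsExist] [difficulty: provable-now] -/
@[route_item "route-CriticalPhenomena-SAWRingGibbsDescent"]
def DomainContinuityOfCommonPins : Prop :=
  PinLocality → CommonPinWallContinuity → CommonPinsExist → DomainContinuity

-- earlier Assembly (stmt-CriticalPhenomena-7532, replaced 2026-08-15T16:44:35Z -> stmt-CriticalPhenomena-11161): retired by None — ∀ (hex : Literature.Probability.RandomPlanarGeometry.exists_isSLECurve), Literature.Probability.RandomPlanarGeometry.IsSLECurve.map_eq → Literature.Probability.RandomPlanarGeometry.IsSLELaw.hullRestriction_eightThirds → Literature.Probability.RandomPlanarGeometry.MarkedD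
/-- item stmt-CriticalPhenomena-11282 · assembly · rank 1 · closed · proved by Summit.CriticalPhenomena.SAWScalingLimit.Theorems.ringGibbsDescent_assembly_proof @ 3ffeb756c9fb (prover) · by planner
sources: Billingsley1999, LawlerSchrammWerner2004SAW, DuminilCopinSmirnov2012
[assembly] SubseqIdentification → EventualTight → SAWScalingLimit (rev 2; provable now). The
deciding theorem `closes` obtains SubseqIdentification from GibbsDescent RingSquaredExcursion
DomainContinuity Rest2Rigidity RingLimitArcs ExcursionRatio EventualTight and applies this item.
Proof sketch: Literature `convergesInLawToSLE_of_isTightMeasureSet_image'` (SLEUniquenessInLaw.lean: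
Prokhorov on the Polish CurveClass ℂ + subsequence principle + IsSLECurve.map_eq_holds) with X δ =
DomainSAW.curve, P δ = SAW.law, SAW.aemeasurable_curve; its `[∀ δ, IsProbabilityMeasure (P δ)]`
instance fails only at junk meshes where a_δ, b_δ are not joined (law = 0), so either rerun its
short proof with `∀ᶠ δ in 𝓝[>]0, IsProbabilityMeasure (law …)` (from IsEndpointApprox.reachable:
weight univ ∈ (0, ∞), finitely many SAWs in the bounded Ω_δ) or swap in a fixed probability measure
at the junk meshes (TendstoLaw and the tight image over Ioc 0 δ₀ with δ₀ below the reachability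
threshold are unchanged). [difficulty: provable-now] -/
@[route_item "route-CriticalPhenomena-SAWRingGibbsDescent", crux]
def Assembly : Prop :=
  SubseqIdentification → EventualTight → _root_.SAWScalingLimit

-- `Assembly` holds: proved by `Summit.CriticalPhenomena.SAWScalingLimit.Theorems.ringGibbsDescent_assembly_proof` @ 3ffeb756c9fb (its module imports this route file, so no `_holds` link can be stated here).

/-! D-0027 §2.1 — DECIDING THEOREM (planner-authored via `route open/edit --closes-file`; by planner-rbadge-CriticalPhenomena-SAWRingGibbsD-9dcee22e-g4-0 2026-08-15T16:55:54Z):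
its hypotheses are this route's items and its conclusion the sub-problem Statement (glue_lint), and it elaborates with this file. -/

@[closes "route-CriticalPhenomena-SAWRingGibbsDescent"] theorem closes : RingSquaredExcursion → DomainContinuity → Rest2Rigidity → RingLimitArcs → GibbsDescent → SubseqIdentification → EventualTight → Rest2Boundary → SLEDomainContinuity → ExcursionRatio → Assembly → _root_.SAWScalingLimit :=
  fun hR hC hI hA hG _hS hT _hRB _hSC hE hAsm => hAsm (hG hR hC hI hA hE hT) hT

end Summit.CriticalPhenomena.SAWScalingLimit.Theses.SAWRingGibbsDescent
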